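import Summits.RiemannHypothesis.RiemannHypothesis.Theses.SpectralTrace
import Summits.RiemannHypothesis.RiemannHypothesis.Theorems.SpectralTraceHeckeSurrogateDefs
import Summits.RiemannHypothesis.RiemannHypothesis.Theorems.SpectralTraceWindowTracePrime2StubXi2Surrogate
import Summits.RiemannHypothesis.RiemannHypothesis.Theorems.SpectralTraceWindowTracePrime2StubLogDerivDiff
import Summits.RiemannHypothesis.RiemannHypothesis.Theorems.SpectralTraceWindowTracePrime2StubZeroCount
import Summits.RiemannHypothesis.RiemannHypothesis.Theorems.SpectralTraceWindowTracePrime2StubContourIdentity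
import Summits.RiemannHypothesis.RiemannHypothesis.Theorems.SpectralTraceWindowTracePrime2StubGoodHeights
import Summits.RiemannHypothesis.RiemannHypothesis.Theorems.SpectralTraceWindowTracePrime2StubZeroSumLimit
import Summits.RiemannHypothesis.RiemannHypothesis.Theorems.SpectralTraceWindowTracePrime2StubWindowAssembly
import Summits.RiemannHypothesis.RiemannHypothesis.Theorems.SpectralTraceWindowTracePrime2StubReduction
import Summits.RiemannHypothesis.RiemannHypothesis.Theorems.SpectralTraceWindowTracePrime2StubHeckeTransfer
import Literature.Uncategorized.GammaLowerBound
import Literature.Uncategorized.GammaLowerBoundProofs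
import Literature.Uncategorized.HorizontalLogDerivBoundProofs
import Literature.NumberTheory.LFunctions.RiemannXiOrder
import Literature.NumberTheory.LFunctions.WeilExplicitFormulaProofs
import Literature.NumberTheory.LFunctions.WeilExplicitRightEdge
import Summits.RiemannHypothesis.RiemannHypothesis.Theorems.WindowTracePrime2.Negative.LoadBearing
import Summits.RiemannHypothesis.RiemannHypothesis.Theorems.WindowTracePrime2.Negative.FiniteFamilies
import HarnessLib

/-!
# Line `hecke-cusp-perturbation-surrogate` — crux `WindowTracePrime2` (stmt-RiemannHypothesis-11196),
# route `SpectralTrace` — LEAD RESHAPE r4 (prover-line-stmt-RiemannHypothesis-11196-c2, 2026-08-16)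

Crux (route decl, FIXED): `∃ (ι : Type) (γ : ι → ℝ), ∀ g, IsWeilTest g → tsupport g ⊆ [-log 3, log 3] →
HasSum (fun i ↦ ĝ(1/2 + iγ_i)) (W g)` — a real unit-multiplicity family reproducing the Weil distribution on
the window `(-log 3, log 3)` (only the prime power `2` enters).

THE LINE (planner skeleton @cc1d2f4ab58d, card `Lines/hecke-cusp-perturbation-surrogate.md`, lead reshape r1
@c1 2026-08-16T21:11Z). Replace `ξ` by an entire function `E` with `ζ`'s polar part, `ζ`'s Gamma factor and
`ζ`'s first two Dirichlet terms `1 + 2^{-s}`, all further frequencies `≥ 3` (`IsSurrogate`): its explicit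
formula coincides with `W` on every Weil test supported in `[-log 3, log 3]` (the RELATIVE explicit formula:
the contour integrals of `(E'/E - ξ₂'/ξ₂)·ĝ` on far-right vertical lines are `O(1/σ)`, hence vanish), so
IF all zeros of `E` are critical their ordinates with multiplicity ARE a witness — integrality by birth
(orders of zeros), exactness by Cauchy's theorem, realness = the one property to force (`stub_selection`).

RESHAPE r2 (this file). State after r1: `stub_gammaLower` LANDED (p125976 + `GammaLowerBound_holds`
p126565), `stub_horizontal` LANDED as the Literature discharge `HorizontalLogDerivBound_holds` (p126974),
`stub_xi2Surrogate` LANDED (p126712). The r1 stub `stub_windowTrace` (contour assembly, XL) is CUT into four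
registered stubs along the tree's own explicit-formula architecture (`WeilExplicitFormulaProofs`:
`weilZeroSidePartial_eq_contour` → good heights → horizontal sides → right edge), each consumed BY NAME:
* `stub_contourIdentity` — the weighted residue theorem for `(F'/F)·ĝ` on `[1-σ, σ] × [-T, T]` with the
  left edge folded by `F(1-s) = F(s)` (generic: `F` entire, symmetric, zero-free on `Re s ≥ σ`; verbatim
  the tree's `weilZeroSidePartial_eq_contour` with `(-1/2, 3/2) ↦ (1-σ, σ)` and `ξ ↦ F`, engine
  `Literature.Analysis.Complex.integral_boundary_rect_logDeriv_mul`);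
* `stub_goodHeights` — for a PAIR of controlled surrogates, every `[t, t+1]` holds a height `T` with the
  horizontal segments `Im s = ±T`, `1-σ ≤ Re s ≤ σ` free of zeros of both and `‖F'/F‖, ‖G'/G‖ ≤ C(1+t)^k`
  there (`HorizontalLogDerivBound` = Landau–Titchmarsh, centre `c = σ_c ± iT` with `|F(c)| ≥ |c(c-1)Γ_ℝ(c)|/2`
  by `RightHalfPlaneControl` and `GammaLowerBound`, `M` from the order bound, `η ≥ 1/poly(t)` by
  `ZeroCountBound` and `Soundararajan2004.exists_height_far_from`);
* `stub_zeroSumLimit` — for `E` entire with `ZeroCountBound E`: `Σ_{i : ZIdx E} |ĝ(ρ_i)| < ∞` and the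
  rectangle zero sums (with `meromorphicOrderAt` multiplicities) tend to `∑' i, ĝ(zval i)` along ANY
  `T_n → ∞` (decay `ĝ = O_k((1+|Im|²)^{-k})` on strips; template `Negative.LoadBearing.hasSum_nontrivialZeros`,
  `EntireZeroSum.summable_analyticOrderNatAt_div_one_add_sq`);
* `stub_windowAssembly` — given the three statements above and the interfaces: contour identities for `E`
  and for `ξ₂` at a common good height, subtracted; horizontal sides `→ 0`; the `ξ₂` zero sum IS
  `weilZeroSidePartial g T → W(g)` (`explicit_formula_holds`); the vertical difference tends to
  `J(σ) = ∫ (E'/E - ξ₂'/ξ₂)(σ+iy) k̂(σ+iy) dy = O(3^{-σ}·3^{σ-1/2}/(σ-1/2)) → 0` (`RightHalfPlaneControl` (ii),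
  `|ĝ(σ+iy)| ≤ 3^{σ-1/2}‖g''‖₁/|s-1/2|²`); so `∑' ĝ(zval i) = W(g)` and `HasSum`.
The r1 stub `stub_heckeTransfer` (Hecke (B) ⇒ (A)) LEAVES the crux path: `stub_selection` is restated over the
surrogate class itself (`∃ E, IsSurrogate E ∧ all zeros critical`) — strictly MORE general than the r1 form
(every real cusp datum of level 9 gives a surrogate), so the bet is only wider; Hecke data remain one supply.
Registered stubs of r2 (7): `stub_logDerivDiff`, `stub_zeroCount`, `stub_contourIdentity`, `stub_goodHeights`,
`stub_zeroSumLimit`, `stub_windowAssembly`, `stub_selection`. RESHAPE r3 (same file, 2026-08-16T22:5xZ): stubs A–F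
ALL LANDED (p128008, p128398, p128555, p128986, p129106, p129745; Literature pieces p128952, p129310) and are
referenced by name below; the composition of A–F with the three landed r1 stubs is registered as ONE provable
stub `stub_reduction : ∀ E, IsSurrogate E → (all zeros critical) → ∀ window tests, HasSum over ZIdx E = W g`
(so that the reduction itself lands under `Theorems/` as a `--supports` file), leaving `stub_selection` (HARDEST; the lead's) as the only
open stub: `WindowTracePrime2_of := stub_reduction stub_selection`. RESHAPE r4 (2026-08-16T23:2xZ): `stub_reduction` LANDED
(p129877, with `windowTracePrime2_of_selection : (∃ E, IsSurrogate E ∧ all zeros critical) → crux`); the SUPPLY of the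
selection is made formal again as in r1: registered `stub_heckeTransfer` (Hecke (B) ⇒ (A): every real cusp datum of level 9
gives a surrogate; provable, Mathlib `WeakFEPair`/`StrongFEPair`) and the bet in the planner's original form
`stub_cuspSelection : ∃ real cusp datum of level 9 with all zeros of E_φ critical`;
`WindowTracePrime2_of := stub_reduction ∘ stub_heckeTransfer ∘ stub_cuspSelection`, the general selection route
being the landed `windowTracePrime2_of_selection`. FINAL STATE (2026-08-16T23:4xZ): `stub_heckeTransfer` LANDED (p130862);
the ONLY `sorry` left is `stub_cuspSelection` — the crux is, kernel-checked, exactly the selection problem away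
(analysis: `Lines/hecke-cusp-perturbation-surrogate-selection.md`).

Disproof used (`Cruxes/WindowTracePrime2/Disproof.lean`, cdisprove cycles 1–2 + §(W), unchanged since
2026-08-16T12:16Z, re-read 21:4xZ): `windowTracePrime2_false_without_IsWeilTest` (landed `Negative/LoadBearing`)
honoured — `IsWeilTest` enters `stub_zeroSumLimit`/`stub_windowAssembly` (decay of `ĝ`); `hasSum_zeros` /
`hasSum_nontrivialZeros` is the template of `stub_zeroSumLimit`; `not_trace_of_finite`, `finite_fibre_of_trace`,
`not_trace_of_ncard_le` (local counts unbounded) are respected by birth (zeros of an order-1 entire function with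
Gamma factor: `N(T) ~ (T/π) log T`, local counts `≍ log T`). No `-- Targets` section exists.
-/

noncomputable section

set_option linter.dupNamespace false

namespace Summit.RiemannHypothesis.RiemannHypothesis.Cruxes.WindowTracePrime2.HeckeCuspPerturbationSurrogate

open Complex Filter Set MeasureTheory
open scoped Real Topology
open Literature.NumberTheory.LFunctions
open Literature.Uncategorized
open Summit.RiemannHypothesis.RiemannHypothesis.Theses.SpectralTrace
open Summit.RiemannHypothesis.RiemannHypothesis.Theorems.HeckeSurrogate

/-! ## Landed stubs (theorems of the tree, referenced by name) -/

/-- **r1 STUB 1 · `stub_gammaLower`** — LANDED (p125976; Literature discharge p126565). [folklore] -/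
theorem stub_gammaLower : GammaLowerBound :=
  Summit.RiemannHypothesis.RiemannHypothesis.Theorems.HeckeSurrogate.stub_gammaLower

/-- **r1 STUB 2 · `stub_horizontal`** — LANDED as `Literature.Uncategorized.HorizontalLogDerivBound_holds`
(p126974). [cite: Titchmarsh1986, §3.9 Lemma α] -/
theorem stub_horizontal : HorizontalLogDerivBound :=
  Literature.Uncategorized.HorizontalLogDerivBound_holds

/-- **r1 STUB 5a · `stub_xi2Surrogate`** — LANDED (p126712). [folklore] -/
theorem stub_xi2Surrogate : IsSurrogate xi2 :=
  Summit.RiemannHypothesis.RiemannHypothesis.Theorems.HeckeSurrogate.stub_xi2Surrogate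

/-! ## The r2 stubs A–F (all LANDED; referenced by name) and the two registered r3 stubs -/

/-- **STUB A · `stub_logDerivDiff`** — right half-plane control of a surrogate: leading-term domination
and `‖E'/E - ξ₂'/ξ₂‖ ≤ C 3^{-σ}` (size M; termwise bounds on `L_E = 1 + 2^{-s} + A`, `L_{ξ₂} = 1 + 2^{-s} + B`
from the Dirichlet data of `IsSurrogate E` and of the landed `IsSurrogate xi2`: `A, A', B, B' = O(3^{-σ})`,
`L_E'L_{ξ₂} - L_E L_{ξ₂}' = u'(B-A) + (A'-B')(1+u) + A'B - AB'`, `u = 2^{-s}`; no `ζ` needed). [cite: Hecke1936, §2] -/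
theorem stub_logDerivDiff : ∀ E : ℂ → ℂ, IsSurrogate E → RightHalfPlaneControl E :=
  Summit.RiemannHypothesis.RiemannHypothesis.Theorems.HeckeSurrogate.stub_logDerivDiff

/-- **STUB B · `stub_zeroCount`** — zeros of a surrogate lie in a strip and have polynomially bounded
local counts with multiplicity (size M/L; Jensen `sum_divisor_le_of_circleAverage_le` on discs centred at
`σ_c + iT`, `σ_c` odd, lower bound at the centre from `GammaLowerBound` + `RightHalfPlaneControl` (i), upper
bound from the order-`≤ 1` growth; template `SelbergDatum.exists_sum_order_window_le`). [cite: Titchmarsh1986, §9.2] -/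
theorem stub_zeroCount :
    GammaLowerBound → (∀ E : ℂ → ℂ, IsSurrogate E → RightHalfPlaneControl E) →
      ∀ E : ℂ → ℂ, IsSurrogate E → ZeroCountBound E :=
  Summit.RiemannHypothesis.RiemannHypothesis.Theorems.HeckeSurrogate.stub_zeroCount

/-- **STUB C · `stub_contourIdentity`** — the weighted residue theorem for `(F'/F)·ĝ` on
`[1-σ, σ] × [-T, T]`, left edge folded onto the right one by `F(1-s) = F(s)` (`k̂ = ĝ + ĝ(1-·)`):
`2πi Σ_{ρ ∈ (1-σ,σ)×(-T,T)} m(ρ) ĝ(ρ) = ∫_bottom − ∫_top + i ∫_{-T}^{T} (F'/F)(σ+iy) k̂(σ+iy) dy`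
(size M; verbatim the tree's `weilZeroSidePartial_eq_contour` for general `F`). [cite: Bombieri2000Weil, §2] -/
theorem stub_contourIdentity :
    ∀ F : ℂ → ℂ, Differentiable ℂ F → (∀ s : ℂ, F (1 - s) = F s) →
      ∀ (σ T : ℝ), 1 / 2 < σ → 0 < T →
        (∀ s : ℂ, σ ≤ s.re → F s ≠ 0) →
        (∀ s : ℂ, F s = 0 → s.im ≠ T ∧ s.im ≠ -T) →
        ∀ g : ℝ → ℂ, IsWeilTest g →
          2 * π * I * ∑ᶠ ρ ∈ {ρ : ℂ | F ρ = 0 ∧ ρ ∈ Set.Ioo (1 - σ) σ ×ℂ Set.Ioo (-T) T},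
              ((meromorphicOrderAt F ρ).untop₀ : ℂ) * weilMellin g ρ =
            (∫ x : ℝ in (1 - σ)..σ, logDeriv F (x + (-T : ℝ) * I) * weilMellin g (x + (-T : ℝ) * I)) -
            (∫ x : ℝ in (1 - σ)..σ, logDeriv F (x + T * I) * weilMellin g (x + T * I)) +
            I * ∫ y : ℝ in (-T)..T, logDeriv F (σ + y * I) * weilMellin (weilSymm g) (σ + y * I) :=
  Summit.RiemannHypothesis.RiemannHypothesis.Theorems.HeckeSurrogate.stub_contourIdentity

/-- **STUB D · `stub_goodHeights`** — good heights for a PAIR of controlled surrogates: every `[t, t+1]`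
(`t ≥ 0`) contains `T` such that no zero of `F` or `G` has ordinate `±T` and on the horizontal segments
`Im s = ±T`, `1-σ ≤ Re s ≤ σ`: `‖F'/F‖, ‖G'/G‖ ≤ C (1+t)^k` (size M/L; `HorizontalLogDerivBound` at centres
`σ_c ± iT`, `σ_c` odd `≥ σ₁`, radius `R = 4(σ_c + σ)`: `M` from the order bound, `|F(c)| ≥ |c(c-1)Γ_ℝ(c)|/2 ≥
e^{-O(T)}` by `RightHalfPlaneControl` (i) + `GammaLowerBound`, separation `η ≥ 1/poly(t)` from `ZeroCountBound`
via `Soundararajan2004.exists_height_far_from`; template `Soundararajan2004.exists_good_height`).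
[cite: Titchmarsh1986, §9.2] -/
theorem stub_goodHeights :
    GammaLowerBound → HorizontalLogDerivBound →
      ∀ F G : ℂ → ℂ, IsSurrogate F → IsSurrogate G →
        RightHalfPlaneControl F → RightHalfPlaneControl G → ZeroCountBound F → ZeroCountBound G →
        ∀ σ : ℝ, 1 / 2 < σ →
          ∃ (C : ℝ) (k : ℕ), ∀ t : ℝ, 0 ≤ t → ∃ T ∈ Set.Icc t (t + 1),
            (∀ s : ℂ, F s = 0 → s.im ≠ T ∧ s.im ≠ -T) ∧ (∀ s : ℂ, G s = 0 → s.im ≠ T ∧ s.im ≠ -T) ∧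
            ∀ x : ℝ, x ∈ Set.Icc (1 - σ) σ →
              ‖logDeriv F (x + T * I)‖ ≤ C * (1 + t) ^ k ∧
              ‖logDeriv F (x + (-T : ℝ) * I)‖ ≤ C * (1 + t) ^ k ∧
              ‖logDeriv G (x + T * I)‖ ≤ C * (1 + t) ^ k ∧
              ‖logDeriv G (x + (-T : ℝ) * I)‖ ≤ C * (1 + t) ^ k :=
  Summit.RiemannHypothesis.RiemannHypothesis.Theorems.HeckeSurrogate.stub_goodHeights

/-- **STUB E · `stub_zeroSumLimit`** — for `E` entire, not identically zero, with `ZeroCountBound E` and all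
zeros in the open strip `1-σ < Re s < σ`: the zero side over `ZIdx E` (multiplicity by `analyticOrderNatAt`)
is absolutely summable for every Weil test, and the rectangle zero sums (multiplicity by `meromorphicOrderAt`)
tend to `∑' i, ĝ(zval i)` along ANY `T_n → +∞` (size M/L; decay `|ĝ(s)| ≤ C_k/(1+(Im s)²)^k` on the strip by
iterating `weilMellin_deriv_deriv`, regrouping over unit windows of ordinates; template
`Negative.LoadBearing.hasSum_nontrivialZeros`, `EntireZeroSum`). [folklore] -/
theorem stub_zeroSumLimit :
    ∀ E : ℂ → ℂ, Differentiable ℂ E → (∃ s : ℂ, E s ≠ 0) → ZeroCountBound E →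
      ∀ σ : ℝ, (∀ s : ℂ, E s = 0 → 1 - σ < s.re ∧ s.re < σ) →
        ∀ g : ℝ → ℂ, IsWeilTest g →
          Summable (fun i : ZIdx E => ‖weilMellin g (zval i)‖) ∧
          ∀ T : ℕ → ℝ, Tendsto T atTop atTop →
            Tendsto (fun n : ℕ => ∑ᶠ ρ ∈ {ρ : ℂ | E ρ = 0 ∧ ρ ∈ Set.Ioo (1 - σ) σ ×ℂ Set.Ioo (-(T n)) (T n)},
                ((meromorphicOrderAt E ρ).untop₀ : ℂ) * weilMellin g ρ) atTop
              (𝓝 (∑' i : ZIdx E, weilMellin g (zval i))) :=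
  Summit.RiemannHypothesis.RiemannHypothesis.Theorems.HeckeSurrogate.stub_zeroSumLimit

/-- **STUB F · `stub_windowAssembly`** — the RELATIVE EXPLICIT FORMULA assembled from STUBS C, D, E and the
interfaces: for a surrogate `E`, the zeros with multiplicity give `HasSum ĝ(ρ) = W(g)` for every Weil test
supported in the window (size L; contour identities for `E` and `ξ₂` at a common good height (STUB D with
`F = E`, `G = xi2`), subtracted; horizontal sides `→ 0` (STUB D bound × decay of `ĝ`); the `ξ₂` zero sum is
`weilZeroSidePartial g T → W g` (`explicit_formula_holds`, `untop₀_meromorphicOrderAt_riemannXi`); the vertical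
difference tends to `J(σ) = ∫ (E'/E - ξ₂'/ξ₂)(σ+iy) k̂(σ+iy) dy` with `|J(σ)| ≤ C 3^{-σ}·2·3^{σ-1/2}‖g''‖₁ π/(σ-1/2)`
(`RightHalfPlaneControl` (ii); `|ĝ(σ+iy)| ≤ 3^{|σ-1/2|}‖g''‖₁/|s-1/2|²` from `weilMellin_deriv_deriv` and the
window support); STUB E identifies the limit with `∑' ĝ(zval i)` for every `σ`, so it is `W(g)`).
[cite: Bombieri2000Weil, §2 Thm 2] -/
theorem stub_windowAssembly :
    (∀ F : ℂ → ℂ, Differentiable ℂ F → (∀ s : ℂ, F (1 - s) = F s) →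
      ∀ (σ T : ℝ), 1 / 2 < σ → 0 < T →
        (∀ s : ℂ, σ ≤ s.re → F s ≠ 0) →
        (∀ s : ℂ, F s = 0 → s.im ≠ T ∧ s.im ≠ -T) →
        ∀ g : ℝ → ℂ, IsWeilTest g →
          2 * π * I * ∑ᶠ ρ ∈ {ρ : ℂ | F ρ = 0 ∧ ρ ∈ Set.Ioo (1 - σ) σ ×ℂ Set.Ioo (-T) T},
              ((meromorphicOrderAt F ρ).untop₀ : ℂ) * weilMellin g ρ =
            (∫ x : ℝ in (1 - σ)..σ, logDeriv F (x + (-T : ℝ) * I) * weilMellin g (x + (-T : ℝ) * I)) -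
            (∫ x : ℝ in (1 - σ)..σ, logDeriv F (x + T * I) * weilMellin g (x + T * I)) +
            I * ∫ y : ℝ in (-T)..T, logDeriv F (σ + y * I) * weilMellin (weilSymm g) (σ + y * I)) →
    (GammaLowerBound → HorizontalLogDerivBound →
      ∀ F G : ℂ → ℂ, IsSurrogate F → IsSurrogate G →
        RightHalfPlaneControl F → RightHalfPlaneControl G → ZeroCountBound F → ZeroCountBound G →
        ∀ σ : ℝ, 1 / 2 < σ →
          ∃ (C : ℝ) (k : ℕ), ∀ t : ℝ, 0 ≤ t → ∃ T ∈ Set.Icc t (t + 1),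
            (∀ s : ℂ, F s = 0 → s.im ≠ T ∧ s.im ≠ -T) ∧ (∀ s : ℂ, G s = 0 → s.im ≠ T ∧ s.im ≠ -T) ∧
            ∀ x : ℝ, x ∈ Set.Icc (1 - σ) σ →
              ‖logDeriv F (x + T * I)‖ ≤ C * (1 + t) ^ k ∧
              ‖logDeriv F (x + (-T : ℝ) * I)‖ ≤ C * (1 + t) ^ k ∧
              ‖logDeriv G (x + T * I)‖ ≤ C * (1 + t) ^ k ∧
              ‖logDeriv G (x + (-T : ℝ) * I)‖ ≤ C * (1 + t) ^ k) →
    (∀ E : ℂ → ℂ, Differentiable ℂ E → (∃ s : ℂ, E s ≠ 0) → ZeroCountBound E →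
      ∀ σ : ℝ, (∀ s : ℂ, E s = 0 → 1 - σ < s.re ∧ s.re < σ) →
        ∀ g : ℝ → ℂ, IsWeilTest g →
          Summable (fun i : ZIdx E => ‖weilMellin g (zval i)‖) ∧
          ∀ T : ℕ → ℝ, Tendsto T atTop atTop →
            Tendsto (fun n : ℕ => ∑ᶠ ρ ∈ {ρ : ℂ | E ρ = 0 ∧ ρ ∈ Set.Ioo (1 - σ) σ ×ℂ Set.Ioo (-(T n)) (T n)},
                ((meromorphicOrderAt E ρ).untop₀ : ℂ) * weilMellin g ρ) atTop
              (𝓝 (∑' i : ZIdx E, weilMellin g (zval i)))) →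
    GammaLowerBound → HorizontalLogDerivBound → IsSurrogate xi2 →
      (∀ E : ℂ → ℂ, IsSurrogate E → RightHalfPlaneControl E) →
      (∀ E : ℂ → ℂ, IsSurrogate E → ZeroCountBound E) →
      ∀ E : ℂ → ℂ, IsSurrogate E →
        ∀ g : ℝ → ℂ, IsWeilTest g → tsupport g ⊆ Set.Icc (-Real.log 3) (Real.log 3) →
          HasSum (fun i : ZIdx E => weilMellin g (zval i)) (weilFunctional g) :=
  Summit.RiemannHypothesis.RiemannHypothesis.Theorems.HeckeSurrogate.stub_windowAssembly

/-- **STUB R · `stub_reduction`** (r3; LANDED p129877 as `Theorems/SpectralTraceWindowTracePrime2StubReduction.lean`,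
with the corollaries `hasSum_weilMellin_zeros_of_isSurrogate` and `windowTracePrime2_of_selection`): the kernel-checked
REDUCTION of the crux to the selection problem — for a window-invisible self-dual degree-one surrogate with all
its zeros on the critical line, the ordinates of its zeros (with multiplicity) realise `Trace(log 3)`.
[cite: Bombieri2000Weil, §2 Thm 2] -/
theorem stub_reduction :
    ∀ E : ℂ → ℂ, IsSurrogate E → (∀ s : ℂ, E s = 0 → s.re = 1 / 2) →
      ∀ g : ℝ → ℂ, IsWeilTest g → tsupport g ⊆ Set.Icc (-Real.log 3) (Real.log 3) →
        HasSum (fun i : ZIdx E => weilMellin g (1 / 2 + (((zval i).im : ℝ) : ℂ) * Complex.I))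
          (weilFunctional g) :=
  Summit.RiemannHypothesis.RiemannHypothesis.Theorems.HeckeSurrogate.stub_reduction

/-- **STUB H · `stub_heckeTransfer`** (r1 stub 5b, back on the path in r4; LANDED p130862, generic theta/Mellin part
`Literature/NumberTheory/ModularForms/WeightHalfThetaMellin.lean` p130762) — Hecke's correspondence `(B) ⇒ (A)`:
every real cusp datum of level 9 gives a surrogate (size M/L; Mathlib `WeakFEPair`/`IsStrongFEPair` with
`f = g = cuspTheta a q`, `k = 1/2`, `ε = 1`, `f₀ = g₀ = 0`: `hasMellin`, `differentiable_Λ`, `functional_equation`;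
order bound from `|φ(t)| ≤ K e^{-9πt}` (`t ≥ 1`), `|φ(t)| ≤ K t^{-1/2} e^{-9π/t}` (`t ≤ 1`) and `Γ(x+1) ≤ (x+2)^{x+2}`;
Dirichlet expansion by termwise Mellin `∫₀^∞ e^{-πqt} t^{s/2-1} dt = (πq)^{-s/2}Γ(s/2)`
(`Complex.integral_cpow_mul_exp_neg_mul_Ioi`) interleaved with the data of the landed `IsSurrogate xi2`
(`tsum_even_add_odd`)). [cite: BerndtKnopp2008, Thm 2.1] -/
theorem stub_heckeTransfer :
    IsSurrogate xi2 → ∀ (a : ℕ → ℝ) (q : ℕ → ℝ), IsCuspDatum a q → IsSurrogate (surrogate a q) :=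
  Summit.RiemannHypothesis.RiemannHypothesis.Theorems.HeckeSurrogate.stub_heckeTransfer

/-- **STUB G · `stub_cuspSelection`** — SELECTION (the card's transfer `C⁺`; research; HARDEST; the lead's), in
the planner's original form: some REAL CUSP DATUM of level 9 makes ALL zeros of
`E_φ = ξ₂ + s(s-1)·(Mellin φ)(s/2)` critical. `RH ⇒` it (`a = 0`, `E_φ = ξ₂`); it `⇏ RH`; no theorem in print
produces or forbids a non-trivial instance. The general form over the surrogate class,
`∃ E, IsSurrogate E ∧ ∀ s, E s = 0 → s.re = 1/2`, also suffices (landed `windowTracePrime2_of_selection`).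
Structure a proof must respect (line card §Hardest; lead analysis `Lines/hecke-cusp-perturbation-surrogate-selection.md`):
(G) first gate `σ > 1` — zero-freeness of `1 + 2^{-s} + Σ_{ν≥3}` on `σ > σ'` is `sup_t |D/ζ| < 1` on the Bohr
closure; (L) on the line both summands are real, critical zeros leave only through collisions; (U) `E = ξ₂(1+U)`,
`U = D/ζ` a general Dirichlet series of frequencies `≥ 3` continuing to a MEROMORPHIC `U(1-s) = U(s)`, necessarily
with poles at every off-line zero of `ζ` (an entire symmetric `U` of finite order is `0`); (Θ) surrogates ⟺ even
self-dual tempered atomic measures `μ = μ̂ = c δ₀ + δ_{±1} + δ_{±2} + (atoms in |x| ≥ 3)`, `c = E(1) ≠ 0`.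
Why it might fail: every heuristic (Davenport–Heilbronn, Bohr–Jessen, Bombieri–Hejhal, Kahane–Mandelbrojt)
expects no instance beyond RH. [cite: Hecke1936, §2] -/
theorem stub_cuspSelection :
    ∃ (a : ℕ → ℝ) (q : ℕ → ℝ), IsCuspDatum a q ∧ ∀ s : ℂ, surrogate a q s = 0 → s.re = 1 / 2 := by
  sorry

namespace Registered

/-- Name-keyed statement of STUB A. [folklore] -/
abbrev stub_logDerivDiff : Prop := ∀ E : ℂ → ℂ, IsSurrogate E → RightHalfPlaneControl E

/-- Name-keyed statement of STUB B. [folklore] -/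
abbrev stub_zeroCount : Prop :=
  GammaLowerBound → (∀ E : ℂ → ℂ, IsSurrogate E → RightHalfPlaneControl E) →
    ∀ E : ℂ → ℂ, IsSurrogate E → ZeroCountBound E

/-- Name-keyed statement of STUB C. [folklore] -/
abbrev stub_contourIdentity : Prop :=
  ∀ F : ℂ → ℂ, Differentiable ℂ F → (∀ s : ℂ, F (1 - s) = F s) →
    ∀ (σ T : ℝ), 1 / 2 < σ → 0 < T →
      (∀ s : ℂ, σ ≤ s.re → F s ≠ 0) →
      (∀ s : ℂ, F s = 0 → s.im ≠ T ∧ s.im ≠ -T) →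
      ∀ g : ℝ → ℂ, IsWeilTest g →
        2 * π * I * ∑ᶠ ρ ∈ {ρ : ℂ | F ρ = 0 ∧ ρ ∈ Set.Ioo (1 - σ) σ ×ℂ Set.Ioo (-T) T},
            ((meromorphicOrderAt F ρ).untop₀ : ℂ) * weilMellin g ρ =
          (∫ x : ℝ in (1 - σ)..σ, logDeriv F (x + (-T : ℝ) * I) * weilMellin g (x + (-T : ℝ) * I)) -
          (∫ x : ℝ in (1 - σ)..σ, logDeriv F (x + T * I) * weilMellin g (x + T * I)) +
          I * ∫ y : ℝ in (-T)..T, logDeriv F (σ + y * I) * weilMellin (weilSymm g) (σ + y * I)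

/-- Name-keyed statement of STUB D. [folklore] -/
abbrev stub_goodHeights : Prop :=
  GammaLowerBound → HorizontalLogDerivBound →
    ∀ F G : ℂ → ℂ, IsSurrogate F → IsSurrogate G →
      RightHalfPlaneControl F → RightHalfPlaneControl G → ZeroCountBound F → ZeroCountBound G →
      ∀ σ : ℝ, 1 / 2 < σ →
        ∃ (C : ℝ) (k : ℕ), ∀ t : ℝ, 0 ≤ t → ∃ T ∈ Set.Icc t (t + 1),
          (∀ s : ℂ, F s = 0 → s.im ≠ T ∧ s.im ≠ -T) ∧ (∀ s : ℂ, G s = 0 → s.im ≠ T ∧ s.im ≠ -T) ∧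
          ∀ x : ℝ, x ∈ Set.Icc (1 - σ) σ →
            ‖logDeriv F (x + T * I)‖ ≤ C * (1 + t) ^ k ∧
            ‖logDeriv F (x + (-T : ℝ) * I)‖ ≤ C * (1 + t) ^ k ∧
            ‖logDeriv G (x + T * I)‖ ≤ C * (1 + t) ^ k ∧
            ‖logDeriv G (x + (-T : ℝ) * I)‖ ≤ C * (1 + t) ^ k

/-- Name-keyed statement of STUB E. [folklore] -/
abbrev stub_zeroSumLimit : Prop :=
  ∀ E : ℂ → ℂ, Differentiable ℂ E → (∃ s : ℂ, E s ≠ 0) → ZeroCountBound E →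
    ∀ σ : ℝ, (∀ s : ℂ, E s = 0 → 1 - σ < s.re ∧ s.re < σ) →
      ∀ g : ℝ → ℂ, IsWeilTest g →
        Summable (fun i : ZIdx E => ‖weilMellin g (zval i)‖) ∧
        ∀ T : ℕ → ℝ, Tendsto T atTop atTop →
          Tendsto (fun n : ℕ => ∑ᶠ ρ ∈ {ρ : ℂ | E ρ = 0 ∧ ρ ∈ Set.Ioo (1 - σ) σ ×ℂ Set.Ioo (-(T n)) (T n)},
              ((meromorphicOrderAt E ρ).untop₀ : ℂ) * weilMellin g ρ) atTop
            (𝓝 (∑' i : ZIdx E, weilMellin g (zval i)))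

/-- Name-keyed statement of STUB F. [folklore] -/
abbrev stub_windowAssembly : Prop :=
  stub_contourIdentity → stub_goodHeights → stub_zeroSumLimit →
    GammaLowerBound → HorizontalLogDerivBound → IsSurrogate xi2 →
      (∀ E : ℂ → ℂ, IsSurrogate E → RightHalfPlaneControl E) →
      (∀ E : ℂ → ℂ, IsSurrogate E → ZeroCountBound E) →
      ∀ E : ℂ → ℂ, IsSurrogate E →
        ∀ g : ℝ → ℂ, IsWeilTest g → tsupport g ⊆ Set.Icc (-Real.log 3) (Real.log 3) →
          HasSum (fun i : ZIdx E => weilMellin g (zval i)) (weilFunctional g)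

/-- Name-keyed statement of STUB R. [folklore] -/
abbrev stub_reduction : Prop :=
  ∀ E : ℂ → ℂ, IsSurrogate E → (∀ s : ℂ, E s = 0 → s.re = 1 / 2) →
    ∀ g : ℝ → ℂ, IsWeilTest g → tsupport g ⊆ Set.Icc (-Real.log 3) (Real.log 3) →
      HasSum (fun i : ZIdx E => weilMellin g (1 / 2 + (((zval i).im : ℝ) : ℂ) * Complex.I))
        (weilFunctional g)

/-- Name-keyed statement of STUB H. [folklore] -/
abbrev stub_heckeTransfer : Prop :=
  IsSurrogate xi2 → ∀ (a : ℕ → ℝ) (q : ℕ → ℝ), IsCuspDatum a q → IsSurrogate (surrogate a q)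

/-- Name-keyed statement of STUB G. [folklore] -/
abbrev stub_cuspSelection : Prop :=
  ∃ (a : ℕ → ℝ) (q : ℕ → ℝ), IsCuspDatum a q ∧ ∀ s : ℂ, surrogate a q s = 0 → s.re = 1 / 2

/-- The general selection statement over the surrogate class (r2/r3 form of STUB G; route landed as
`HeckeSurrogate.windowTracePrime2_of_selection`). [folklore] -/
abbrev selection : Prop :=
  ∃ E : ℂ → ℂ, IsSurrogate E ∧ ∀ s : ℂ, E s = 0 → s.re = 1 / 2

end Registered

/-- The stubs ARE their registered statements (definitionally). [folklore] -/
theorem stubs_are_registered :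
    (Registered.stub_logDerivDiff ↔ ∀ E : ℂ → ℂ, IsSurrogate E → RightHalfPlaneControl E) ∧
    (Registered.stub_cuspSelection ↔
      ∃ (a : ℕ → ℝ) (q : ℕ → ℝ), IsCuspDatum a q ∧ ∀ s : ℂ, surrogate a q s = 0 → s.re = 1 / 2) :=
  ⟨Iff.rfl, Iff.rfl⟩

/-! ## The composition (sorry-free) -/

/-- The r1 interface `stub_windowTrace`, now DERIVED from STUBS C–F: the zeros of a surrogate with
multiplicity give `HasSum ĝ(ρ) = W(g)` on the window. [cite: Bombieri2000Weil, §2 Thm 2] -/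
theorem windowTrace_of (hC : Registered.stub_contourIdentity) (hD : Registered.stub_goodHeights)
    (hE : Registered.stub_zeroSumLimit) (hF : Registered.stub_windowAssembly)
    (h₁ : GammaLowerBound) (h₂ : HorizontalLogDerivBound) (h₅ : IsSurrogate xi2)
    (h₃ : Registered.stub_logDerivDiff) (h₄ : Registered.stub_zeroCount) :
    ∀ E : ℂ → ℂ, IsSurrogate E →
      ∀ g : ℝ → ℂ, IsWeilTest g → tsupport g ⊆ Set.Icc (-Real.log 3) (Real.log 3) →
        HasSum (fun i : ZIdx E => weilMellin g (zval i)) (weilFunctional g) :=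
  hF hC hD hE h₁ h₂ h₅ h₃ (h₄ h₁ h₃)

/-- The transfer `C⁺ → crux` assembled from the stubs: for a surrogate all of whose zeros are critical,
the ordinates of the zeros (with multiplicity) realise the window trace. [folklore] -/
theorem windowTracePrime2_of_surrogate (hC : Registered.stub_contourIdentity)
    (hD : Registered.stub_goodHeights) (hE : Registered.stub_zeroSumLimit)
    (hF : Registered.stub_windowAssembly) (h₁ : GammaLowerBound) (h₂ : HorizontalLogDerivBound)
    (h₅ : IsSurrogate xi2) (h₃ : Registered.stub_logDerivDiff) (h₄ : Registered.stub_zeroCount)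
    {E : ℂ → ℂ} (hS : IsSurrogate E) (hcrit : ∀ s : ℂ, E s = 0 → s.re = 1 / 2) :
    ∀ g : ℝ → ℂ, IsWeilTest g → tsupport g ⊆ Set.Icc (-Real.log 3) (Real.log 3) →
      HasSum (fun i : ZIdx E => weilMellin g (1 / 2 + (((zval i).im : ℝ) : ℂ) * Complex.I))
        (weilFunctional g) := by
  intro g hg hsupp
  have h := windowTrace_of hC hD hE hF h₁ h₂ h₅ h₃ h₄ E hS g hg hsupp
  have heq : ∀ i : ZIdx E, (1 / 2 : ℂ) + (((zval i).im : ℝ) : ℂ) * Complex.I = zval i := by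
    intro i
    have hre : (zval i).re = 1 / 2 := hcrit _ i.1.2
    apply Complex.ext <;> simp [hre]
  simpa only [heq] using h

/-- **`WindowTracePrime2_of`** — the two registered open r4 stubs ⇒ the crux, BY NAME (the landed `stub_reduction`
and the three landed r1 stubs are discharged inside): the witness is
`ι = ZIdx E_φ` (zeros of the surrogate of the selected cusp datum, with multiplicity), `γ_i = Im ρ_i`. [folklore] -/
theorem WindowTracePrime2_of (hH : Registered.stub_heckeTransfer) (hG : Registered.stub_cuspSelection) :
    Summit.RiemannHypothesis.RiemannHypothesis.Theses.SpectralTrace.WindowTracePrime2 := by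
  have hR : Registered.stub_reduction := stub_reduction   -- landed (p129877): discharged here
  obtain ⟨a, q, hD, hcrit⟩ := hG
  exact ⟨ZIdx (surrogate a q), fun i => (zval i).im, hR (surrogate a q) (hH stub_xi2Surrogate a q hD) hcrit⟩

/-- Cusp selection ⇒ general selection (given the transfer). [folklore] -/
theorem selection_of_cusp (hH : Registered.stub_heckeTransfer) (hG : Registered.stub_cuspSelection) :
    Registered.selection := by
  obtain ⟨a, q, hD, hcrit⟩ := hG
  exact ⟨surrogate a q, hH stub_xi2Surrogate a q hD, hcrit⟩

/-- The general route (r2/r3): selection over the surrogate class ⇒ the crux, LANDED (p129877). [folklore] -/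
example (hG : Registered.selection) :
    Summit.RiemannHypothesis.RiemannHypothesis.Theses.SpectralTrace.WindowTracePrime2 :=
  Summit.RiemannHypothesis.RiemannHypothesis.Theorems.HeckeSurrogate.windowTracePrime2_of_selection hG

/-- The REDUCTION assembled from the r2 stubs A–F, BY NAME (the three landed r1 stubs are discharged inside):
for a surrogate all of whose zeros are critical the ordinates reproduce `W` on the window. This is the proof of
`stub_reduction` that lands under `Theorems/`. [folklore] -/
theorem reduction_of_stubs (hA : Registered.stub_logDerivDiff) (hB : Registered.stub_zeroCount)
    (hC : Registered.stub_contourIdentity) (hD : Registered.stub_goodHeights)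
    (hE : Registered.stub_zeroSumLimit) (hF : Registered.stub_windowAssembly) :
    Registered.stub_reduction := by
  have h₁ : GammaLowerBound := stub_gammaLower           -- landed (p125976 / p126565)
  have h₂ : HorizontalLogDerivBound := stub_horizontal   -- landed (p126974)
  have h₅ : IsSurrogate xi2 := stub_xi2Surrogate         -- landed (p126712)
  intro E hS hcrit
  exact windowTracePrime2_of_surrogate hC hD hE hF h₁ h₂ h₅ hA hB hS hcrit

/-- The r3 stub `stub_reduction` is inhabited TODAY by the landed stubs A–F (no `sorry` involved). [folklore] -/
theorem stub_reduction_holds : Registered.stub_reduction :=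
  reduction_of_stubs stub_logDerivDiff stub_zeroCount stub_contourIdentity stub_goodHeights
    stub_zeroSumLimit stub_windowAssembly

/-- The sorried stubs inhabit the registered names (so the skeleton composes today, modulo `sorry`). [folklore] -/
example : Summit.RiemannHypothesis.RiemannHypothesis.Theses.SpectralTrace.WindowTracePrime2 :=
  WindowTracePrime2_of stub_heckeTransfer stub_cuspSelection

/-! ## Sanity: RH ⇒ selection; the landed Negative lemmas -/

/-- Under RH the degenerate member `ξ₂` is a selection (so STUB G is RH-implied, as the crux is; the cusp form with
`a = 0` likewise, since `surrogate 0 q = xi2`). [folklore] -/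
theorem selection_of_riemannHypothesis (hRH : _root_.RiemannHypothesis) :
    Registered.selection := by
  refine ⟨xi2, stub_xi2Surrogate, fun s hs => ?_⟩
  have hxi : riemannXi s = 0 := by
    have h2 : (2 : ℂ) * riemannXi s = 0 := hs
    simpa using h2
  obtain ⟨hζ, h0, h1, him⟩ := riemannXi_zero_prop hxi
  refine hRH s hζ ?_ (by rintro rfl; norm_num at h1)
  rintro ⟨n, hn⟩
  have : (0 : ℝ) < s.re := h0
  rw [hn] at this
  simp at this
  linarith

example : ¬ ∃ (ι : Type) (γ : ι → ℝ), ∀ g : ℝ → ℂ,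
    tsupport g ⊆ Set.Icc (-Real.log 3) (Real.log 3) →
      HasSum (fun i => weilMellin g (1 / 2 + (γ i : ℂ) * Complex.I)) (weilFunctional g) :=
  Summit.RiemannHypothesis.RiemannHypothesis.Theorems.WindowTracePrime2.Negative.windowTracePrime2_false_without_IsWeilTest

example : ¬ ∃ (ι : Type) (_ : Finite ι) (γ : ι → ℝ), ∀ g : ℝ → ℂ, IsWeilTest g →
    tsupport g ⊆ Set.Icc (-Real.log 3) (Real.log 3) →
      HasSum (fun i => weilMellin g (1 / 2 + (γ i : ℂ) * Complex.I)) (weilFunctional g) :=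
  Summit.RiemannHypothesis.RiemannHypothesis.Theorems.WindowTracePrime2.Negative.not_windowTracePrime2_finite

end Summit.RiemannHypothesis.RiemannHypothesis.Cruxes.WindowTracePrime2.HeckeCuspPerturbationSurrogate

end
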